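import Summits.ValiantsHypothesis.ValiantsHypothesis.Theorems.DefinabilityGapPrimePencilPatterns
import HarnessLib

/-!
# DefinabilityGap — the PRIME PENCIL: every affine combination of (zeroed) block permanents is prime

Route `route-ValiantsHypothesis-DefinabilityGap` (decomp-valiant cycle 1, lens 5: hardness–randomness / PIT axis); size road
of the residual `KIPlantedHitting` (stmt-ValiantsHypothesis-23547; census cells W5 / W19), read-once leaf F4 / W10
(`KIPlantedHittingRO`, stmt-ValiantsHypothesis-23704). `G_m : y ↦ (P_c(y))_c`, `P_c = kiPer m c`, and the zeroed block
permanents `Q^F_c = kiPerZ m F c` of `DefinabilityGapZeroedBlocks`; `pencil m F a α = C α + ∑_c C (a c) · Q^F_c` and the block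
patterns `bpat` are in `DefinabilityGapPrimePencilPatterns`.

The base of the zero-out / peeling induction so far was ONE surviving block (`kiPerZ_prime`). Here the base becomes the
whole affine PENCIL spanned by the survivors:

* `vars_factor_pencil_trivial` (`m ≥ 3`, some `a c ≠ 0`, every block with `a c ≠ 0` has seen `≤ m − 2` zeros): if
  `g · h = pencil`, one factor has no variables. Von zur Gathen's variable-splitting argument run on the whole seed
  universe `𝔽_q × 𝔽_q`: the pencil is multilinear, so the factor supports separate; a hybrid of two avoiding permutation
  monomials of a block `c` has `m ≥ 3` cells inside the cells of `c`, hence (design intersections `≤ 2`,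
  `card_cells_inter_le`) is a permutation monomial of `c` itself, so rows and columns propagate inside each block and every
  live block is a `g`-block (all free cells are variables of `g`) or an `h`-block (none is); a `g`-block `c₁` together with an
  `h`-block `c₂` would put the `2m`-cell monomial `bpat c₁ π₁ + bpat c₂ π₂` into `g · h`, whose monomials all have `m`
  or `0` cells — so all live blocks are on one side and the other factor is constant (the shift `C α` rides along);
* `pencil_irreducible`, `pencil_prime`; `kiPer_pencil_prime`: `C α + ∑_c C (a c) · P_c` is prime for every `a ≠ 0` and
  every `α`; `kiPer_linearCombination_prime`.
0 sorry.
-/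

noncomputable section

open MvPolynomial
open Literature.Computability.AlgebraicComplexity Literature.Computability.MetaComplexity

namespace Summit.ValiantsHypothesis.ValiantsHypothesis.Theorems.DefinabilityGapPrimePencil

open Summit.ValiantsHypothesis.ValiantsHypothesis.Theorems.DefinabilityGapAffineRung
open Summit.ValiantsHypothesis.ValiantsHypothesis.Theorems.DefinabilityGapShiftedPrimes
open Summit.ValiantsHypothesis.ValiantsHypothesis.Theorems.DefinabilityGapPatternPermanent
open Summit.ValiantsHypothesis.ValiantsHypothesis.Theorems.DefinabilityGapZeroedBlocks
open Summit.ValiantsHypothesis.ValiantsHypothesis.Theorems.DefinabilityGapPrimePencilPatterns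

variable {m : ℕ}

/-! ## 1. Factors of the pencil split no block and no pair of blocks -/

/-- **Key step.** If `g · h` is a pencil member with a live block, and every live block has seen `≤ m − 2` zeros
(`m ≥ 3`), then `g` or `h` has no variables. [this file] -/
theorem vars_factor_pencil_trivial (hm : 3 ≤ m) {F : Finset (Fin (qOf m) × Fin (qOf m))}
    {a : (Fin 3 → Fin (qOf m)) → ℂ} {α : ℂ} (hA : ∃ c, a c ≠ 0)
    (hmar : ∀ c, a c ≠ 0 → (patOf m F c).card + 2 ≤ m)
    {g h : MvPolynomial (Fin (qOf m) × Fin (qOf m)) ℂ} (hgh : g * h = pencil m F a α) :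
    (∀ d ∈ g.support, d = 0) ∨ (∀ d ∈ h.support, d = 0) := by
  classical
  obtain ⟨c₀, hc₀⟩ := hA
  have hm1 : 1 ≤ m := by omega
  have hcard : ∀ c, a c ≠ 0 → (patOf m F c).card + 2 ≤ Fintype.card (Fin m) := fun c hc => by
    rw [Fintype.card_fin]; exact hmar c hc
  have hne : g * h ≠ 0 := by rw [hgh]; exact pencil_ne_zero hm hc₀ (hmar c₀ hc₀)
  have hg0 : g ≠ 0 := left_ne_zero_of_mul hne
  have hh0 : h ≠ 0 := right_ne_zero_of_mul hne
  have hdeg : ∀ v, degreeOf v g + degreeOf v h ≤ 1 := fun v => by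
    rw [← degreeOf_mul_eq hg0 hh0, hgh]; exact degreeOf_pencil_le F a α v
  set S : Finset (Fin (qOf m) × Fin (qOf m)) := Finset.univ.filter fun v => degreeOf v g ≠ 0 with hS
  have hgS : ∀ d ∈ g.support, ∀ v, d v ≠ 0 → v ∈ S := fun d hd v hv => by
    rw [hS, Finset.mem_filter]
    refine ⟨Finset.mem_univ _, fun h0 => hv ?_⟩
    have := monomial_le_degreeOf v hd
    omega
  have hhS : ∀ d ∈ h.support, ∀ v, d v ≠ 0 → v ∉ S := fun d hd v hv hvS => by
    rw [hS, Finset.mem_filter] at hvS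
    have h1 := monomial_le_degreeOf v hd
    have h2 := hdeg v
    omega
  -- (F1) every avoiding permutation monomial of a live block splits with coefficient product `a c`
  have F1 : ∀ c, a c ≠ 0 → ∀ π : Equiv.Perm (Fin m), Avoids (patOf m F c) π →
      coeff ((bpat m c π).filter (· ∈ S)) g * coeff ((bpat m c π).filter (¬ · ∈ S)) h = a c :=
    fun c hc π hπ => by rw [← coeff_mul_of_separated S hgS hhS, hgh, coeff_bpat_pencil hm, if_pos hπ]
  -- (F2) non-zero hybrids of two avoiding permutations of the SAME block are permutation monomials of that block
  have F2 : ∀ c, a c ≠ 0 → ∀ π π' : Equiv.Perm (Fin m), Avoids (patOf m F c) π → Avoids (patOf m F c) π' →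
      (bpat m c π).filter (· ∈ S) + (bpat m c π').filter (¬ · ∈ S) ≠ 0 →
      ∃ ρ : Equiv.Perm (Fin m), permMonomial ρ =
        (permMonomial π).filter (fun rc => cellEmb m c rc ∈ S) +
          (permMonomial π').filter (fun rc => ¬ cellEmb m c rc ∈ S) := by
    intro c hc π π' hπ hπ' hν0
    set ν := (bpat m c π).filter (· ∈ S) + (bpat m c π').filter (¬ · ∈ S) with hν
    have e1 : ν.filter (· ∈ S) = (bpat m c π).filter (· ∈ S) := by
      ext v; simp only [hν, Finsupp.filter_apply, Finsupp.add_apply]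
      by_cases hv : v ∈ S <;> simp [hv]
    have e2 : ν.filter (¬ · ∈ S) = (bpat m c π').filter (¬ · ∈ S) := by
      ext v; simp only [hν, Finsupp.filter_apply, Finsupp.add_apply]
      by_cases hv : v ∈ S <;> simp [hv]
    have hcoeff : coeff ν (g * h) ≠ 0 := by
      rw [coeff_mul_of_separated S hgS hhS, e1, e2]
      have h1 := F1 c hc π hπ
      have h2 := F1 c hc π' hπ'
      exact mul_ne_zero (left_ne_zero_of_mul (ne_of_eq_of_ne h1 hc)) (right_ne_zero_of_mul (ne_of_eq_of_ne h2 hc))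
    rw [hgh] at hcoeff
    obtain ⟨c'', ρ, -, -, hρν⟩ := exists_of_coeff_pencil_ne_zero hν0 hcoeff
    have hνsub : ν.support ⊆ cells m c := by
      intro x hx
      rw [Finsupp.mem_support_iff] at hx
      by_contra hxc
      apply hx
      rw [hν, Finsupp.add_apply, Finsupp.filter_apply, Finsupp.filter_apply, bpat_apply_of_notMem_cells c π hxc,
        bpat_apply_of_notMem_cells c π' hxc]
      simp
    have hcc : c'' = c := by
      by_contra hcc
      have h1 : (bpat m c'' ρ).support ⊆ cells m c'' ∩ cells m c := by
        refine Finset.subset_inter (support_bpat_subset_cells c'' ρ) ?_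
        rw [hρν]; exact hνsub
      have := (Finset.card_le_card h1).trans (card_cells_inter_le hcc)
      rw [card_support_bpat] at this
      omega
    rw [hcc] at hρν
    refine ⟨ρ, ?_⟩
    ext rc
    have hval := DFunLike.congr_fun hρν (cellEmb m c rc)
    rw [bpat_apply_cellEmb] at hval
    rw [hval, hν, Finsupp.add_apply, Finsupp.filter_apply, Finsupp.filter_apply, Finsupp.add_apply,
      Finsupp.filter_apply, Finsupp.filter_apply, bpat_apply_cellEmb, bpat_apply_cellEmb]
  -- (F3) rows: inside a live block, moves between free cells of a row stay in `S`
  have F3 : ∀ c, a c ≠ 0 → ∀ r b b' : Fin m, (r, b) ∉ patOf m F c → (r, b') ∉ patOf m F c →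
      cellEmb m c (r, b) ∈ S → cellEmb m c (r, b') ∈ S := by
    intro c hc r b b' hb hb' hrb
    obtain ⟨π, hπb, hπ⟩ := exists_perm_through_avoids (patOf m F c) (hcard c hc) (r, b) hb
    obtain ⟨π', hπb', hπ'⟩ := exists_perm_through_avoids (patOf m F c) (hcard c hc) (r, b') hb'
    simp only at hπb hπb'
    have hν0 : (bpat m c π).filter (· ∈ S) + (bpat m c π').filter (¬ · ∈ S) ≠ 0 := by
      intro h0
      have := DFunLike.congr_fun h0 (cellEmb m c (r, b))
      rw [Finsupp.add_apply, Finsupp.filter_apply, if_pos hrb, bpat_apply_cellEmb, permMonomial_apply,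
        if_pos hπb, Finsupp.zero_apply] at this
      omega
    obtain ⟨ρ, hρ⟩ := F2 c hc π π' hπ hπ' hν0
    have e1 : π.symm r = b := π.symm_apply_eq.2 hπb.symm
    have e2 : π'.symm r = b' := π'.symm_apply_eq.2 hπb'.symm
    have := rowCount_permMonomial ρ r
    rw [hρ, rowCount_add, rowCount_filter_permMonomial, rowCount_filter_permMonomial, e1, e2, if_pos hrb] at this
    by_contra hb'S
    rw [if_pos hb'S] at this
    omega
  -- (F4) columns
  have F4 : ∀ c, a c ≠ 0 → ∀ j i i' : Fin m, (i, j) ∉ patOf m F c → (i', j) ∉ patOf m F c →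
      cellEmb m c (i, j) ∈ S → cellEmb m c (i', j) ∈ S := by
    intro c hc j i i' hi hi' hij
    obtain ⟨π, hπi, hπ⟩ := exists_perm_through_avoids (patOf m F c) (hcard c hc) (i, j) hi
    obtain ⟨π', hπi', hπ'⟩ := exists_perm_through_avoids (patOf m F c) (hcard c hc) (i', j) hi'
    simp only at hπi hπi'
    have hν0 : (bpat m c π).filter (· ∈ S) + (bpat m c π').filter (¬ · ∈ S) ≠ 0 := by
      intro h0
      have := DFunLike.congr_fun h0 (cellEmb m c (i, j))
      rw [Finsupp.add_apply, Finsupp.filter_apply, if_pos hij, bpat_apply_cellEmb, permMonomial_apply,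
        if_pos hπi, Finsupp.zero_apply] at this
      omega
    obtain ⟨ρ, hρ⟩ := F2 c hc π π' hπ hπ' hν0
    have := colCount_permMonomial ρ j
    rw [hρ, colCount_add, colCount_filter_permMonomial, colCount_filter_permMonomial, hπi, hπi', if_pos hij] at this
    by_contra hi'S
    rw [if_pos hi'S] at this
    omega
  -- dichotomy: every live block is a `g`-block or an `h`-block
  have dich : ∀ c, a c ≠ 0 →
      (∀ rc : Fin m × Fin m, rc ∉ patOf m F c → cellEmb m c rc ∈ S) ∨
        (∀ rc : Fin m × Fin m, rc ∉ patOf m F c → cellEmb m c rc ∉ S) := by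
    intro c hc
    by_cases hex : ∃ rc : Fin m × Fin m, rc ∉ patOf m F c ∧ cellEmb m c rc ∈ S
    · left
      obtain ⟨⟨i₀, j₀⟩, hN₀, hS₀⟩ := hex
      obtain ⟨j₁, hj₁⟩ := exists_col_notMem (patOf m F c) (by have := hcard c hc; omega)
      rintro ⟨i, j⟩ hij
      exact F3 c hc i j₁ j (hj₁ i) hij
        (F4 c hc j₁ i₀ i (hj₁ i₀) (hj₁ i) (F3 c hc i₀ j₀ j₁ hN₀ (hj₁ i₀) hS₀))
    · right
      intro rc hrc hS'
      exact hex ⟨rc, hrc, hS'⟩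
  -- cells of avoiding patterns of `g`-blocks lie in `S`, of `h`-blocks outside `S`
  have cellS : ∀ c (π : Equiv.Perm (Fin m)), Avoids (patOf m F c) π →
      (∀ rc : Fin m × Fin m, rc ∉ patOf m F c → cellEmb m c rc ∈ S) → ∀ x, bpat m c π x ≠ 0 → x ∈ S := by
    intro c π hπ hgb x hx
    obtain ⟨i, rfl⟩ := exists_eq_cellEmb_of_bpat_ne_zero hx
    exact hgb (π i, i) (hπ i)
  have cellS' : ∀ c (π : Equiv.Perm (Fin m)), Avoids (patOf m F c) π →
      (∀ rc : Fin m × Fin m, rc ∉ patOf m F c → cellEmb m c rc ∉ S) → ∀ x, bpat m c π x ≠ 0 → x ∉ S := by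
    intro c π hπ hhb x hx
    obtain ⟨i, rfl⟩ := exists_eq_cellEmb_of_bpat_ne_zero hx
    exact hhb (π i, i) (hπ i)
  -- no `g`-block can coexist with an `h`-block: the product monomial would have `2m` cells
  have nosplit : ∀ c₁ c₂, a c₁ ≠ 0 → a c₂ ≠ 0 →
      (∀ rc : Fin m × Fin m, rc ∉ patOf m F c₁ → cellEmb m c₁ rc ∈ S) →
      (∀ rc : Fin m × Fin m, rc ∉ patOf m F c₂ → cellEmb m c₂ rc ∉ S) → False := by
    intro c₁ c₂ hc₁ hc₂ hg₁ hh₂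
    obtain ⟨π₁, hπ₁⟩ := exists_avoids (patOf m F c₁) (hcard c₁ hc₁)
    obtain ⟨π₂, hπ₂⟩ := exists_avoids (patOf m F c₂) (hcard c₂ hc₂)
    have h1S := cellS c₁ π₁ hπ₁ hg₁
    have h2S := cellS' c₂ π₂ hπ₂ hh₂
    have f1 : (bpat m c₁ π₁).filter (· ∈ S) = bpat m c₁ π₁ := by
      ext x; rw [Finsupp.filter_apply]
      by_cases hx : x ∈ S
      · rw [if_pos hx]
      · rw [if_neg hx]; by_contra h0; exact hx (h1S x (Ne.symm h0))
    have f1' : (bpat m c₁ π₁).filter (¬ · ∈ S) = 0 := by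
      ext x; rw [Finsupp.filter_apply, Finsupp.zero_apply]
      by_cases hx : x ∈ S
      · rw [if_neg (not_not.2 hx)]
      · rw [if_pos hx]; by_contra h0; exact hx (h1S x h0)
    have f2 : (bpat m c₂ π₂).filter (¬ · ∈ S) = bpat m c₂ π₂ := by
      ext x; rw [Finsupp.filter_apply]
      by_cases hx : x ∈ S
      · rw [if_neg (not_not.2 hx)]; by_contra h0; exact h2S x (Ne.symm h0) hx
      · rw [if_pos hx]
    have f2' : (bpat m c₂ π₂).filter (· ∈ S) = 0 := by
      ext x; rw [Finsupp.filter_apply, Finsupp.zero_apply]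
      by_cases hx : x ∈ S
      · rw [if_pos hx]; by_contra h0; exact h2S x h0 hx
      · rw [if_neg hx]
    have hgc : coeff (bpat m c₁ π₁) g ≠ 0 := by
      have := F1 c₁ hc₁ π₁ hπ₁
      rw [f1, f1'] at this
      exact left_ne_zero_of_mul (ne_of_eq_of_ne this hc₁)
    have hhc : coeff (bpat m c₂ π₂) h ≠ 0 := by
      have := F1 c₂ hc₂ π₂ hπ₂
      rw [f2, f2'] at this
      exact right_ne_zero_of_mul (ne_of_eq_of_ne this hc₂)
    have e1 : (bpat m c₁ π₁ + bpat m c₂ π₂).filter (· ∈ S) = bpat m c₁ π₁ := by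
      ext x; rw [Finsupp.filter_apply, Finsupp.add_apply]
      by_cases hx : x ∈ S
      · rw [if_pos hx]
        have : bpat m c₂ π₂ x = 0 := by by_contra h0; exact h2S x h0 hx
        rw [this, add_zero]
      · rw [if_neg hx]; by_contra h0; exact hx (h1S x (Ne.symm h0))
    have e2 : (bpat m c₁ π₁ + bpat m c₂ π₂).filter (¬ · ∈ S) = bpat m c₂ π₂ := by
      ext x; rw [Finsupp.filter_apply, Finsupp.add_apply]
      by_cases hx : x ∈ S
      · rw [if_neg (not_not.2 hx)]; by_contra h0; exact h2S x (Ne.symm h0) hx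
      · rw [if_pos hx]
        have : bpat m c₁ π₁ x = 0 := by by_contra h0; exact hx (h1S x h0)
        rw [this, zero_add]
    have hcoeff : coeff (bpat m c₁ π₁ + bpat m c₂ π₂) (g * h) ≠ 0 := by
      rw [coeff_mul_of_separated S hgS hhS, e1, e2]
      exact mul_ne_zero hgc hhc
    rw [hgh] at hcoeff
    have hd0 : bpat m c₁ π₁ + bpat m c₂ π₂ ≠ 0 := by
      intro h0
      have := DFunLike.congr_fun h0 (cellEmb m c₁ (π₁ ⟨0, hm1⟩, ⟨0, hm1⟩))
      rw [Finsupp.add_apply, bpat_apply_cellEmb, permMonomial_apply, if_pos rfl, Finsupp.zero_apply] at this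
      omega
    obtain ⟨c₃, ρ, -, -, hρ⟩ := exists_of_coeff_pencil_ne_zero hd0 hcoeff
    have hdisj : Disjoint (bpat m c₁ π₁).support (bpat m c₂ π₂).support := by
      rw [Finset.disjoint_left]
      intro x hx1 hx2
      exact h2S x (Finsupp.mem_support_iff.1 hx2) (h1S x (Finsupp.mem_support_iff.1 hx1))
    have hc3 := card_support_bpat c₃ ρ
    rw [hρ, Finsupp.support_add_eq hdisj, Finset.card_union_of_disjoint hdisj, card_support_bpat,
      card_support_bpat] at hc3
    omega
  -- all live blocks are on one side
  have hside : (∀ c, a c ≠ 0 → ∀ rc : Fin m × Fin m, rc ∉ patOf m F c → cellEmb m c rc ∈ S) ∨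
      (∀ c, a c ≠ 0 → ∀ rc : Fin m × Fin m, rc ∉ patOf m F c → cellEmb m c rc ∉ S) := by
    rcases dich c₀ hc₀ with h₀ | h₀
    · left
      intro c hc
      rcases dich c hc with h1 | h1
      · exact h1
      · exact (nosplit c₀ c hc₀ hc h₀ h1).elim
    · right
      intro c hc
      rcases dich c hc with h1 | h1
      · exact (nosplit c c₀ hc hc₀ h1 h₀).elim
      · exact h1
  rcases hside with hall | hnone
  · -- `h` has no variables
    right
    intro d hd
    ext v
    rw [Finsupp.zero_apply]
    by_contra hv
    have hvS : v ∉ S := hhS d hd v hv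
    have hdh : degreeOf v h ≠ 0 := by
      intro h0
      have := monomial_le_degreeOf v hd
      rw [h0] at this
      exact hv (Nat.eq_zero_of_le_zero this)
    have hP : degreeOf v (pencil m F a α) ≠ 0 := by
      rw [← hgh, degreeOf_mul_eq hg0 hh0]; omega
    obtain ⟨c, rc, hc, hrc, rfl⟩ := exists_of_degreeOf_pencil_ne_zero hP
    exact hvS (hall c hc rc hrc)
  · -- `g` has no variables
    left
    intro d hd
    ext v
    rw [Finsupp.zero_apply]
    by_contra hv
    have hvS : v ∈ S := hgS d hd v hv
    have hdg : degreeOf v g ≠ 0 := by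
      intro h0
      have := monomial_le_degreeOf v hd
      rw [h0] at this
      exact hv (Nat.eq_zero_of_le_zero this)
    have hP : degreeOf v (pencil m F a α) ≠ 0 := by
      rw [← hgh, degreeOf_mul_eq hg0 hh0]; omega
    obtain ⟨c, rc, hc, hrc, rfl⟩ := exists_of_degreeOf_pencil_ne_zero hP
    exact hnone c hc rc hrc hvS

/-! ## 2. The pencil is prime -/

/-- **Every member of the pencil of zeroed block permanents with a live block is irreducible** (`m ≥ 3`; every live block has
seen `≤ m − 2` zeros). [this file] -/
theorem pencil_irreducible (hm : 3 ≤ m) {F : Finset (Fin (qOf m) × Fin (qOf m))} {a : (Fin 3 → Fin (qOf m)) → ℂ}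
    {α : ℂ} (hA : ∃ c, a c ≠ 0) (hmar : ∀ c, a c ≠ 0 → (patOf m F c).card + 2 ≤ m) :
    Irreducible (pencil m F a α) := by
  classical
  obtain ⟨c₀, hc₀⟩ := hA
  obtain ⟨π₀, hπ₀⟩ := exists_avoids (patOf m F c₀) (by rw [Fintype.card_fin]; exact hmar c₀ hc₀)
  have key0 := coeff_bpat_pencil hm F a α c₀ π₀
  rw [if_pos hπ₀] at key0
  refine ⟨fun hu => ?_, fun g h hgh => ?_⟩
  · obtain ⟨r, -, hr⟩ := MvPolynomial.isUnit_iff_eq_C_of_isReduced.1 hu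
    rw [hr, coeff_C, if_neg (bpat_ne_zero (by omega) c₀ π₀).symm] at key0
    exact hc₀ key0.symm
  · rcases vars_factor_pencil_trivial hm ⟨c₀, hc₀⟩ hmar hgh.symm with hg | hh
    · left
      have hgC := eq_C_of_support_subset_zero hg
      have key : coeff 0 g * coeff (bpat m c₀ π₀) h = a c₀ := by
        have := congrArg (coeff (bpat m c₀ π₀)) hgh
        rw [coeff_bpat_pencil hm, if_pos hπ₀, hgC, coeff_C_mul] at this
        exact this.symm
      rw [hgC]
      exact (isUnit_iff_ne_zero.2 (left_ne_zero_of_mul (ne_of_eq_of_ne key hc₀))).map C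
    · right
      have hhC := eq_C_of_support_subset_zero hh
      have key : coeff (bpat m c₀ π₀) g * coeff 0 h = a c₀ := by
        have := congrArg (coeff (bpat m c₀ π₀)) hgh
        rw [coeff_bpat_pencil hm, if_pos hπ₀, hhC, mul_comm, coeff_C_mul] at this
        rw [mul_comm]
        exact this.symm
      rw [hhC]
      exact (isUnit_iff_ne_zero.2 (right_ne_zero_of_mul (ne_of_eq_of_ne key hc₀))).map C

/-- **… hence PRIME in `ℂ[y]`.** [this file] -/
theorem pencil_prime (hm : 3 ≤ m) {F : Finset (Fin (qOf m) × Fin (qOf m))} {a : (Fin 3 → Fin (qOf m)) → ℂ} {α : ℂ}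
    (hA : ∃ c, a c ≠ 0) (hmar : ∀ c, a c ≠ 0 → (patOf m F c).card + 2 ≤ m) : Prime (pencil m F a α) :=
  UniqueFactorizationMonoid.irreducible_iff_prime.1 (pencil_irreducible hm hA hmar)

/-- **The prime pencil of `G_m`**: `C α + ∑_c C (a c) · P_c` is prime for every `a ≠ 0` and every `α` (`m ≥ 3`). [this file] -/
theorem kiPer_pencil_prime (hm : 3 ≤ m) (a : (Fin 3 → Fin (qOf m)) → ℂ) (ha : a ≠ 0) (α : ℂ) :
    Prime (C α + ∑ c, C (a c) * kiPer m c) := by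
  have hA : ∃ c, a c ≠ 0 := by
    by_contra h
    push Not at h
    exact ha (funext h)
  have key := pencil_prime hm (F := ∅) (α := α) hA (fun c _ => by rw [patOf_empty, Finset.card_empty]; omega)
  simpa only [pencil, kiPerZ_empty] using key

/-- In particular every non-trivial LINEAR combination `∑_c a_c · P_c` is prime (`m ≥ 3`). [this file] -/
theorem kiPer_linearCombination_prime (hm : 3 ≤ m) (a : (Fin 3 → Fin (qOf m)) → ℂ) (ha : a ≠ 0) :
    Prime (∑ c, C (a c) * kiPer m c) := by
  simpa only [C_0, zero_add] using kiPer_pencil_prime hm a ha 0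

end Summit.ValiantsHypothesis.ValiantsHypothesis.Theorems.DefinabilityGapPrimePencil
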